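import Summits.HodgeConjecture.HodgeCM.PerL34.RestrictedMeasureBorel_1

/-! PORT of `HodgeCM/PerL34/RestrictedMeasureBorel.lean` (HodgeCMPerL run 81) — part 2: continuation of `Summits.HodgeConjecture.HodgeCM.PerL34.RestrictedMeasureBorel_1` (split at a top-level declaration boundary by port_pkg.py; scope re-opened below; declarations unchanged). -/

-- port_pkg: scope re-opened for this part (file-level context, then the namespace/section stack open at the cut)
set_option autoImplicit false
noncomputable section
open MeasureTheory Set Filter Function Topology
open scoped RestrictedProduct ENNReal NNReal
namespace HodgeCM.PerL34.RestrictedMeasure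
universe u v
variable {ι : Type u} {G : ι → Type v} [∀ i, Group (G i)] [∀ i, TopologicalSpace (G i)]
  [∀ i, IsTopologicalGroup (G i)] [∀ i, T2Space (G i)] [∀ i, SecondCountableTopology (G i)]
  [∀ i, MeasurableSpace (G i)] [∀ i, BorelSpace (G i)] [Countable ι]
  (B : ∀ i, Subgroup (G i)) [hBo : Fact (∀ i, IsOpen (B i : Set (G i)))]
  (S₀ : Finset ι) (C : ∀ i, TopologicalSpace.PositiveCompacts (G i))
variable (ν : ∀ i, Measure (G i)) [∀ i, SigmaFinite (ν i)]
variable [∀ i, (ν i).IsHaarMeasure]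
/-- **Haar uniqueness transfer.**  Every σ-finite left-invariant Borel measure on the restricted
product group is an explicit scalar multiple of the restricted product measure — hence has the
product property of Leahy 3.1.8 / the Euler factorisation 3.1.9 up to that scalar. -/
theorem eq_smul_rpMeasure (hBc : ∀ i, i ∉ S₀ → IsCompact (B i : Set (G i)))
    (hB1 : ∀ i, i ∉ S₀ → ν i (B i : Set (G i)) = 1)
    (μ' : Measure (Πʳ i, [G i, B i])) [SigmaFinite μ'] [μ'.IsMulLeftInvariant] :
    μ' = (μ' (haarBox B S₀ C) * (∏ i : {i // i ∈ S₀}, ν i (C i : Set (G i)))⁻¹) •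
      rpMeasure (fun i => (B i : Set (G i))) ν S₀ := by
  have hBm : ∀ i, MeasurableSet (B i : Set (G i)) := fun i => (hBo.out i).measurableSet
  haveI : BorelSpace (Πʳ i, [G i, B i]) := borelSpace (fun i => (B i : Set (G i))) hBm
  haveI : SecondCountableTopology (Πʳ i, [G i, B i]) :=
    secondCountableTopology (fun i => (B i : Set (G i))) hBo.out
  haveI := sigmaFinite_rpMeasure (fun i => (B i : Set (G i))) ν hBm (S₀ := S₀) hB1
  haveI := isMulLeftInvariant_rpMeasure B ν hBm hB1
  have h1 := Measure.haarMeasure_unique μ' (haarCompacts B S₀ C hBc)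
  have h2 := Measure.haarMeasure_unique (rpMeasure (fun i => (B i : Set (G i))) ν S₀)
    (haarCompacts B S₀ C hBc)
  have ha : rpMeasure (fun i => (B i : Set (G i))) ν S₀ (haarCompacts B S₀ C hBc) =
      ∏ i : {i // i ∈ S₀}, ν i (C i : Set (G i)) := rpMeasure_haarBox B S₀ C ν hB1
  rw [ha] at h2
  have h3 : Measure.haarMeasure (haarCompacts B S₀ C hBc) =
      (∏ i : {i // i ∈ S₀}, ν i (C i : Set (G i)))⁻¹ •
        rpMeasure (fun i => (B i : Set (G i))) ν S₀ := by
    rw [h2, smul_smul, ENNReal.inv_mul_cancel (prod_haar_ne_zero S₀ C ν) (prod_haar_ne_top S₀ C ν),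
      one_smul]
  rw [h3, smul_smul] at h1
  exact h1

/-- The same for Mathlib's Haar measures as local inputs (`ν i := haarMeasure (K i)` with
`↑(K i) = ↑(B i)`): no normalisation hypothesis is left. -/
theorem eq_smul_rpMeasure_haar (K : ∀ i, TopologicalSpace.PositiveCompacts (G i))
    (hBK : ∀ i, (K i : Set (G i)) = B i)
    (μ' : Measure (Πʳ i, [G i, B i])) [SigmaFinite μ'] [μ'.IsMulLeftInvariant] :
    ∃ c : ℝ≥0∞, μ' = c • rpMeasure (fun i => (B i : Set (G i))) (fun i => Measure.haarMeasure (K i)) S₀ := by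
  have hBc : ∀ i, i ∉ S₀ → IsCompact (B i : Set (G i)) := fun i _ => (hBK i) ▸ (K i).isCompact
  have hB1 : ∀ i, i ∉ S₀ → Measure.haarMeasure (K i) (B i : Set (G i)) = 1 :=
    fun i _ => by rw [← hBK i]; exact Measure.haarMeasure_self
  exact ⟨_, eq_smul_rpMeasure B S₀ K (fun i => Measure.haarMeasure (K i)) hBc hB1 μ'⟩


/-! ## Every left-invariant measure on the restricted product group is a restricted product measure

Rescaling one local measure inside `S₀` rescales the restricted product measure (`rpMeasure_eq_smul`);
combined with `eq_smul_rpMeasure` this shows that EVERY σ-finite left-invariant measure `μ'`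
equals `rpMeasure` for the local measures rescaled at one place `i₀ ∈ S₀` — so pv11's
`RestrictedProductMeasureDatum` exists with `μ := μ'` on the nose (`ofLeftInvariant`, `ofLeftInvariant_μ`). -/

end HodgeCM.PerL34.RestrictedMeasure

namespace HodgeCM.PerL34.RestrictedMeasure

universe u v

section rescale

variable {ι : Type u} {G : ι → Type v} [∀ i, MeasurableSpace (G i)] [Countable ι]
  (K : ∀ i, Set (G i)) (hKne : ∀ i, (K i).Nonempty)

omit [Countable ι] in
/-- (Ported verbatim from the HodgeCMPerL package; no docstring in the source.) -/
theorem kap_congr {ν ν' : ∀ i, Measure (G i)} {i : ι} (h : ν' i = ν i) :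
    kap K ν' hKne i = kap K ν hKne i := by
  unfold kap; rw [h]

omit [Countable ι] in
/-- (Ported verbatim from the HodgeCMPerL package; no docstring in the source.) -/
theorem rho_congr {ν ν' : ∀ i, Measure (G i)} (S : Finset ι) (h : ∀ i, i ∉ S → ν' i = ν i) :
    rho K ν' hKne S = rho K ν hKne S := by
  unfold rho
  congr 1
  funext i
  exact kap_congr K hKne (h i i.2)

include hKne in
/-- Rescaling the local measure at one place `i₀ ∈ S₀` by `c` rescales the restricted product
measure by `c`. -/
theorem rpMeasure_eq_smul (ν ν' : ∀ i, Measure (G i)) [∀ i, SigmaFinite (ν i)]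
    [∀ i, SigmaFinite (ν' i)] (hKm : ∀ i, MeasurableSet (K i)) {S₀ : Finset ι}
    (hK1 : ∀ i, i ∉ S₀ → ν i (K i) = 1) {i₀ : ι} (hi₀ : i₀ ∈ S₀) (c : ℝ≥0∞)
    (h0 : ν' i₀ = c • ν i₀) (hne : ∀ i, i ≠ i₀ → ν' i = ν i) :
    rpMeasure K ν' S₀ = c • rpMeasure K ν S₀ := by
  classical
  have hK1' : ∀ i, i ∉ S₀ → ν' i (K i) = 1 := fun i hi => by
    rw [hne i (fun h => hi (h ▸ hi₀))]; exact hK1 i hi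
  symm
  refine eq_rpMeasure K ν' hKne hKm hK1' _ fun S hS => ?_
  haveI := isProbabilityMeasure_rho K ν hKne hKm S
  rw [Measure.restrict_smul, rpMeasure_restrict_rpBox K ν hKne hKm hK1 hS, ← Measure.map_smul,
    ← Measure.prod_smul_left, rho_congr K hKne S (fun i hi => hne i (fun h => hi (h ▸ hS hi₀)))]
  congr 2
  symm
  refine Measure.pi_eq fun s _ => ?_
  have hj₀ : (⟨i₀, hS hi₀⟩ : {i // i ∈ S}) ∈ (Finset.univ : Finset {i // i ∈ S}) :=
    Finset.mem_univ _
  rw [Measure.smul_apply, smul_eq_mul, Measure.pi_pi,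
    ← Finset.mul_prod_erase Finset.univ (fun j : {i // i ∈ S} => ν j (s j)) hj₀,
    ← Finset.mul_prod_erase Finset.univ (fun j : {i // i ∈ S} => ν' j (s j)) hj₀, ← mul_assoc]
  congr 1
  · show c * ν i₀ (s ⟨i₀, hS hi₀⟩) = ν' i₀ (s ⟨i₀, hS hi₀⟩)
    rw [h0, Measure.smul_apply, smul_eq_mul]
  · refine Finset.prod_congr rfl fun j hj => ?_
    rw [hne j (fun h => (Finset.ne_of_mem_erase hj) (Subtype.ext h))]

omit [Countable ι] in
/-- σ-finiteness survives rescaling one local measure by a finite constant. -/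
theorem sigmaFinite_update [DecidableEq ι] (ν : ∀ i, Measure (G i)) [∀ i, SigmaFinite (ν i)]
    (i₀ : ι) (c : ℝ≥0) (i : ι) : SigmaFinite (Function.update ν i₀ (c • ν i₀) i) := by
  by_cases h : i = i₀
  · subst h; rw [Function.update_self]; infer_instance
  · rw [Function.update_of_ne h]; infer_instance

end rescale

section anyHaar

variable {ι : Type u} {G : ι → Type v} [∀ i, Group (G i)] [∀ i, TopologicalSpace (G i)]
  [∀ i, IsTopologicalGroup (G i)] [∀ i, T2Space (G i)] [∀ i, SecondCountableTopology (G i)]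
  [∀ i, MeasurableSpace (G i)] [∀ i, BorelSpace (G i)] [Countable ι] [DecidableEq ι]
  (B : ∀ i, Subgroup (G i)) [hBo : Fact (∀ i, IsOpen (B i : Set (G i)))]
  (S₀ : Finset ι) (C : ∀ i, TopologicalSpace.PositiveCompacts (G i))
  (ν : ∀ i, Measure (G i)) [∀ i, SigmaFinite (ν i)] [∀ i, (ν i).IsHaarMeasure]

omit [∀ i, T2Space (G i)] [DecidableEq ι] [∀ i, SigmaFinite (ν i)] [∀ i, (ν i).IsHaarMeasure] in
/-- A σ-finite left-invariant Borel measure on the restricted product group is FINITE on `K₀`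
(automatic: Haar uniqueness `μ' = μ' K₀ • haarMeasure K₀` and σ-finiteness exclude `μ' K₀ = ∞`). -/
theorem measure_haarBox_ne_top (hBc : ∀ i, i ∉ S₀ → IsCompact (B i : Set (G i)))
    (μ' : Measure (Πʳ i, [G i, B i])) [SigmaFinite μ'] [μ'.IsMulLeftInvariant] :
    μ' (haarBox B S₀ C) ≠ ∞ := by
  have hBm : ∀ i, MeasurableSet (B i : Set (G i)) := fun i => (hBo.out i).measurableSet
  haveI : BorelSpace (Πʳ i, [G i, B i]) := borelSpace (fun i => (B i : Set (G i))) hBm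
  haveI : SecondCountableTopology (Πʳ i, [G i, B i]) :=
    secondCountableTopology (fun i => (B i : Set (G i))) hBo.out
  intro h
  have h1 := Measure.haarMeasure_unique μ' (haarCompacts B S₀ C hBc)
  have hK : ((haarCompacts B S₀ C hBc : Set (Πʳ i, [G i, B i]))) = haarBox B S₀ C := rfl
  rw [hK, h] at h1
  have hS : ∀ n, Measure.haarMeasure (haarCompacts B S₀ C hBc) (spanningSets μ' n) = 0 := fun n => by
    by_contra hne
    have hlt := measure_spanningSets_lt_top μ' n
    have e := congrArg (fun m : Measure (Πʳ i, [G i, B i]) => m (spanningSets μ' n)) h1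
    simp only [Measure.smul_apply, smul_eq_mul, ENNReal.top_mul hne] at e
    rw [e] at hlt
    exact lt_irrefl _ hlt
  have huniv : Measure.haarMeasure (haarCompacts B S₀ C hBc) (univ : Set (Πʳ i, [G i, B i])) = 0 := by
    rw [← iUnion_spanningSets μ']; exact measure_iUnion_null hS
  have h2 : Measure.haarMeasure (haarCompacts B S₀ C hBc)
      (haarCompacts B S₀ C hBc : Set (Πʳ i, [G i, B i])) = 0 :=
    measure_mono_null (subset_univ _) huniv
  rw [Measure.haarMeasure_self] at h2
  exact one_ne_zero h2

/-- The rescaling constant `c(μ') = μ'(K₀) / ∏_{i∈S₀} ν_i(C_i)` as an `ℝ≥0`. -/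
def haarScalar (μ' : Measure (Πʳ i, [G i, B i])) : ℝ≥0 :=
  (μ' (haarBox B S₀ C) * (∏ i : {i // i ∈ S₀}, ν i (C i : Set (G i)))⁻¹).toNNReal

/-- **Every σ-finite left-invariant measure `μ'` on `Πʳ i, [G i, B i]` IS the restricted product
measure of the local measures rescaled at one place `i₀ ∈ S₀`.** -/
theorem eq_rpMeasure_update (hBc : ∀ i, i ∉ S₀ → IsCompact (B i : Set (G i)))
    (hB1 : ∀ i, i ∉ S₀ → ν i (B i : Set (G i)) = 1) {i₀ : ι} (hi₀ : i₀ ∈ S₀)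
    (μ' : Measure (Πʳ i, [G i, B i])) [SigmaFinite μ'] [μ'.IsMulLeftInvariant] :
    μ' = rpMeasure (fun i => (B i : Set (G i)))
      (Function.update ν i₀ (haarScalar B S₀ C ν μ' • ν i₀)) S₀ := by
  have hfin : μ' (haarBox B S₀ C) ≠ ∞ := measure_haarBox_ne_top B S₀ C hBc μ'
  have hBm : ∀ i, MeasurableSet (B i : Set (G i)) := fun i => (hBo.out i).measurableSet
  have hKne : ∀ i, ((B i : Set (G i))).Nonempty := fun i => ⟨1, (B i).one_mem⟩
  haveI := sigmaFinite_update ν i₀ (haarScalar B S₀ C ν μ')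
  have hc : ((haarScalar B S₀ C ν μ' : ℝ≥0) : ℝ≥0∞) =
      μ' (haarBox B S₀ C) * (∏ i : {i // i ∈ S₀}, ν i (C i : Set (G i)))⁻¹ :=
    ENNReal.coe_toNNReal (ENNReal.mul_ne_top hfin (ENNReal.inv_ne_top.2 (prod_haar_ne_zero S₀ C ν)))
  rw [rpMeasure_eq_smul (fun i => (B i : Set (G i))) hKne ν _ hBm hB1 hi₀
      ((haarScalar B S₀ C ν μ' : ℝ≥0) : ℝ≥0∞) _ (fun i hi => Function.update_of_ne hi _ _), hc]
  · exact eq_smul_rpMeasure B S₀ C ν hBc hB1 μ'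
  · rw [Function.update_self]
    ext s
    simp only [Measure.smul_apply, smul_eq_mul, Measure.nnreal_smul_coe_apply]

end anyHaar

end HodgeCM.PerL34.RestrictedMeasure

/-! ## The datum of `AdelicFactorisation` for an ARBITRARY left-invariant measure -/

namespace HodgeCM.PerL34.AdelicFactorisation.RestrictedProductMeasureDatum

universe u v

section ofEq

variable {ι : Type u} {G : ι → Type v} [∀ i, Group (G i)] [∀ i, TopologicalSpace (G i)]
  [∀ i, MeasurableSpace (G i)] [Countable ι] [DecidableEq ι]
  (B : ∀ i, Subgroup (G i)) [hBo : Fact (∀ i, IsOpen (B i : Set (G i)))]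
  [∀ i, OpensMeasurableSpace (G i)] (S₀ : Finset ι)
  (ν : ∀ i, Measure (G i)) [∀ i, SigmaFinite (ν i)]

/-- The datum with measure field `μ'`, for any `μ'` known to equal the restricted product measure of
the local measures rescaled by `c` at `i₀ ∈ S₀`. -/
def ofEq (c : ℝ≥0) {i₀ : ι} (hi₀ : i₀ ∈ S₀) (hB1 : ∀ i, i ∉ S₀ → ν i (B i : Set (G i)) = 1)
    (μ' : Measure (Πʳ i, [G i, B i]))
    (hμ : μ' = RestrictedMeasure.rpMeasure (fun i => (B i : Set (G i)))
      (Function.update ν i₀ (c • ν i₀)) S₀) :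
    RestrictedProductMeasureDatum ι G (Πʳ i, [G i, (B i : Set (G i))]) :=
  haveI := RestrictedMeasure.sigmaFinite_update ν i₀ c
  have hBm : ∀ i, MeasurableSet (B i : Set (G i)) := fun i => (hBo.out i).measurableSet
  have hKne : ∀ i, ((B i : Set (G i))).Nonempty := fun i => ⟨1, (B i).one_mem⟩
  have hB1' : ∀ i, i ∉ S₀ → Function.update ν i₀ (c • ν i₀) i (B i : Set (G i)) = 1 :=
    fun i hi => by
      rw [Function.update_of_ne (fun h : i = i₀ => hi (h ▸ hi₀))]; exact hB1 i hi
  { ofLocal (fun i => (B i : Set (G i))) (Function.update ν i₀ (c • ν i₀)) S₀ hBm hKne hB1' with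
    μ := μ'
    restrict_eq := fun S hS => by
      subst hμ
      exact (ofLocal (fun i => (B i : Set (G i))) (Function.update ν i₀ (c • ν i₀)) S₀ hBm hKne
        hB1').restrict_eq S hS }

/-- (Ported verbatim from the HodgeCMPerL package; no docstring in the source.) -/
theorem ofEq_μ (c : ℝ≥0) {i₀ : ι} (hi₀ : i₀ ∈ S₀) (hB1 : ∀ i, i ∉ S₀ → ν i (B i : Set (G i)) = 1)
    (μ' : Measure (Πʳ i, [G i, B i]))
    (hμ : μ' = RestrictedMeasure.rpMeasure (fun i => (B i : Set (G i)))
      (Function.update ν i₀ (c • ν i₀)) S₀) :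
    (ofEq B S₀ ν c hi₀ hB1 μ' hμ).μ = μ' := rfl

/-- (Ported verbatim from the HodgeCMPerL package; no docstring in the source.) -/
theorem ofEq_ν (c : ℝ≥0) {i₀ : ι} (hi₀ : i₀ ∈ S₀) (hB1 : ∀ i, i ∉ S₀ → ν i (B i : Set (G i)) = 1)
    (μ' : Measure (Πʳ i, [G i, B i]))
    (hμ : μ' = RestrictedMeasure.rpMeasure (fun i => (B i : Set (G i)))
      (Function.update ν i₀ (c • ν i₀)) S₀) :
    (ofEq B S₀ ν c hi₀ hB1 μ' hμ).ν = Function.update ν i₀ (c • ν i₀) := rfl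

/-- (Ported verbatim from the HodgeCMPerL package; no docstring in the source.) -/
theorem ofEq_S₀ (c : ℝ≥0) {i₀ : ι} (hi₀ : i₀ ∈ S₀) (hB1 : ∀ i, i ∉ S₀ → ν i (B i : Set (G i)) = 1)
    (μ' : Measure (Πʳ i, [G i, B i]))
    (hμ : μ' = RestrictedMeasure.rpMeasure (fun i => (B i : Set (G i)))
      (Function.update ν i₀ (c • ν i₀)) S₀) :
    (ofEq B S₀ ν c hi₀ hB1 μ' hμ).S₀ = S₀ := rfl

end ofEq

section ofLeftInvariant

variable {ι : Type u} {G : ι → Type v} [∀ i, Group (G i)] [∀ i, TopologicalSpace (G i)]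
  [∀ i, IsTopologicalGroup (G i)] [∀ i, T2Space (G i)] [∀ i, SecondCountableTopology (G i)]
  [∀ i, MeasurableSpace (G i)] [∀ i, BorelSpace (G i)] [Countable ι] [DecidableEq ι]
  (B : ∀ i, Subgroup (G i)) [hBo : Fact (∀ i, IsOpen (B i : Set (G i)))]
  (S₀ : Finset ι) (C : ∀ i, TopologicalSpace.PositiveCompacts (G i))
  (ν : ∀ i, Measure (G i)) [∀ i, SigmaFinite (ν i)] [∀ i, (ν i).IsHaarMeasure]

/-- **pv11's datum for ANY σ-finite left-invariant measure `μ'` on the restricted product group** — e.g. "the" Haar measure of a paper, whatever its normalisation: local measures =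
the given local Haar measures `ν i`, rescaled at the single place `i₀ ∈ S₀` by
`c = μ'(K₀) / ∏_{i∈S₀} ν_i(C_i)`; measure field `μ := μ'` ON THE NOSE (`ofLeftInvariant_μ`, `rfl`). -/
def ofLeftInvariant (hBc : ∀ i, i ∉ S₀ → IsCompact (B i : Set (G i)))
    (hB1 : ∀ i, i ∉ S₀ → ν i (B i : Set (G i)) = 1) {i₀ : ι} (hi₀ : i₀ ∈ S₀)
    (μ' : Measure (Πʳ i, [G i, B i])) [SigmaFinite μ'] [μ'.IsMulLeftInvariant] :
    RestrictedProductMeasureDatum ι G (Πʳ i, [G i, (B i : Set (G i))]) :=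
  ofEq B S₀ ν (RestrictedMeasure.haarScalar B S₀ C ν μ') hi₀ hB1 μ'
    (RestrictedMeasure.eq_rpMeasure_update B S₀ C ν hBc hB1 hi₀ μ')

/-- (Ported verbatim from the HodgeCMPerL package; no docstring in the source.) -/
theorem ofLeftInvariant_μ (hBc : ∀ i, i ∉ S₀ → IsCompact (B i : Set (G i)))
    (hB1 : ∀ i, i ∉ S₀ → ν i (B i : Set (G i)) = 1) {i₀ : ι} (hi₀ : i₀ ∈ S₀)
    (μ' : Measure (Πʳ i, [G i, B i])) [SigmaFinite μ'] [μ'.IsMulLeftInvariant] :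
    (ofLeftInvariant B S₀ C ν hBc hB1 hi₀ μ').μ = μ' := rfl

/-- (Ported verbatim from the HodgeCMPerL package; no docstring in the source.) -/
theorem ofLeftInvariant_ν (hBc : ∀ i, i ∉ S₀ → IsCompact (B i : Set (G i)))
    (hB1 : ∀ i, i ∉ S₀ → ν i (B i : Set (G i)) = 1) {i₀ : ι} (hi₀ : i₀ ∈ S₀)
    (μ' : Measure (Πʳ i, [G i, B i])) [SigmaFinite μ'] [μ'.IsMulLeftInvariant] :
    (ofLeftInvariant B S₀ C ν hBc hB1 hi₀ μ').ν =
      Function.update ν i₀ (RestrictedMeasure.haarScalar B S₀ C ν μ' • ν i₀) := rfl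

/-- (Ported verbatim from the HodgeCMPerL package; no docstring in the source.) -/
theorem ofLeftInvariant_S₀ (hBc : ∀ i, i ∉ S₀ → IsCompact (B i : Set (G i)))
    (hB1 : ∀ i, i ∉ S₀ → ν i (B i : Set (G i)) = 1) {i₀ : ι} (hi₀ : i₀ ∈ S₀)
    (μ' : Measure (Πʳ i, [G i, B i])) [SigmaFinite μ'] [μ'.IsMulLeftInvariant] :
    (ofLeftInvariant B S₀ C ν hBc hB1 hi₀ μ').S₀ = S₀ := rfl

end ofLeftInvariant

end HodgeCM.PerL34.AdelicFactorisation.RestrictedProductMeasureDatum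

-- port_pkg: scope closed for this part
end
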